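import Mathlib
import HarnessLib
import Summits.HubbardSuperconductivity.HubbardSuperconductivity.Theorems.KLProgrammeH10TwoPointLimitSymbolAngularFactor

/-!
# Route `KLProgramme` — engine support, route (L2) symbol layer: the ANGULAR FACTOR of the SINGLE-multiplier symbol — one plateaued angular
# profile times the smooth square cutoff — smooth on all of `ℝ²`, bounded by `1`, supported in the sector, vanishing beyond the zone, with line
# derivatives of orders `1, 2, 3` of sizes `O(2ⁿ‖w‖)`, `O(4ⁿ‖w‖²)`, `O(8ⁿ‖w‖³)` on the Fermi region of the square

Cell `gate-hubbard-kl`, seat p3 (g10); the one-factor / order-three twin of p4's `…H10TwoPointLimitSymbolAngularFactor` (two factors, orders `≤ 2`),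
for W1 of the (E4)ₙ supply of stmt-HubbardSuperconductivity-20437 (the weighted torus bound of ONE level-`n` sector function `klAnisoFamily … n ω`;
located risk «(b)-Wt@j≥1», cure W1-MIXED).  The factor `Z` of the continuum symbol `G(k₀² + e²)·Z` of a single smooth angular sector:
`Z(p) = χ_sq(p₀²)χ_sq(p₁²) · [R(p)ζ̃_{n,ω}(θ(p))]`, `R = radialCutoffC ½`, `χ_sq = gnCutoff ((π+z)²/π²) ((π+z)²)`.  For `Z` given by this formula
(hypothesis `hZ`):

* `angularFactor₁_smooth_abs_zone` (ONE bundle: `Z ∈ C^∞`, `|Z| ≤ 1`, `|p_j| ≥ π + z ⇒ Z p = 0` — bundled so as not to shadow the pair file's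
  statement shapes), `angularFactor₁_nonneg`, `angularFactor₁_support` (`Z p ≠ 0 ⇒ ζ̃ ≠ 0`), `angularFactor₁_line_eventuallyEq`
  (near a point of the open square the square cutoffs are `≡ 1`);
* `abs_iteratedDeriv_plateaued_line_le₃` — at a point with `‖·‖ ≥ 1`, for `i ≤ 3`: `|∂_σⁱ[R·ζ̃_{n,ω}∘θ]| ≤ 6B((1 + 6/w_n)‖w₁ + iw₂‖)ⁱ`
  (`B` the constant of `exists_norm_iteratedDeriv_sectorWeightCirc_polarAngle_line_le 3`);
* **`abs_derivs_angularFactor₁_line_le`** — at a point `p₀ + s•w` of the open square with `‖·‖ ≥ 1`: `|∂ₛⁱZ| ≤ 6B·Dⁱ` for `i = 1, 2, 3`,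
  `D = (1 + 6/w_n)‖w₁ + iw₂‖`.

Everything is proved; no definitions, no named facts. [folklore] (BGM 2006 §2.5 (2.45)–(2.46), Lemma 2.2.)
-/

noncomputable section

namespace Summit.HubbardSuperconductivity.HubbardSuperconductivity.Theorems.TorusFourierL2

set_option linter.dupNamespace false -- summit = problem name (single-conjunct summit), D-0017

open Set Filter Topology Complex Literature.MathematicalPhysics.QuantumLattice Literature.Analysis.SpecialFunctions
open scoped Real Nat

/-! ### §1 The one-factor angular factor: smoothness, size, support, zone -/

section Angular

variable {z : ℝ} {n : ℕ} {ω : ℤ} {Z : (Fin 2 → ℝ) → ℝ}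
  (hZ : ∀ p, Z p = gnCutoff ((π + z) ^ 2 / π ^ 2) ((π + z) ^ 2) (p 0 ^ 2) * gnCutoff ((π + z) ^ 2 / π ^ 2) ((π + z) ^ 2) (p 1 ^ 2) *
    (radialCutoffC (1 / 2) (momToComplex p) * sectorWeightCirc n ω (polarAngle p)))
include hZ

/-- `0 ≤ Z` (all factors take values in `[0, 1]`). [folklore] -/
theorem angularFactor₁_nonneg (p : Fin 2 → ℝ) : 0 ≤ Z p := by
  rw [hZ]
  exact mul_nonneg (mul_nonneg (gnCutoff_mem_Icc _ _ _).1 (gnCutoff_mem_Icc _ _ _).1)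
    (mul_nonneg (radialCutoffC_mem_Icc _ _).1 (sectorWeightCirc_nonneg _ _ _))

/-- **Support**: `Z(p) ≠ 0 ⇒ ζ̃_{n,ω}(θ(p)) ≠ 0`. [folklore] -/
theorem angularFactor₁_support {p : Fin 2 → ℝ} (h : Z p ≠ 0) : sectorWeightCirc n ω (polarAngle p) ≠ 0 := by
  rw [hZ] at h
  obtain ⟨-, h2⟩ := mul_ne_zero_iff.1 h
  exact (mul_ne_zero_iff.1 h2).2

/-- **Smoothness, size and zone of the one-factor angular factor** (one bundle): `Z ∈ C^∞(ℝ²)`, `|Z| ≤ 1`, and `Z(p) = 0` as soon as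
`|p_j| ≥ π + z` for some `j` (`z > 0`). [folklore] -/
theorem angularFactor₁_smooth_abs_zone (hz : 0 < z) :
    (∀ m : ℕ∞, ContDiff ℝ m Z) ∧ (∀ p, |Z p| ≤ 1) ∧ ∀ p : Fin 2 → ℝ, (∃ j, π + z ≤ |p j|) → Z p = 0 := by
  refine ⟨fun m => ?_, fun p => ?_, fun p h => ?_⟩
  · -- smoothness
    have hfun : Z = fun p => gnCutoff ((π + z) ^ 2 / π ^ 2) ((π + z) ^ 2) (p 0 ^ 2) * gnCutoff ((π + z) ^ 2 / π ^ 2) ((π + z) ^ 2) (p 1 ^ 2) *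
        (radialCutoffC (1 / 2) (momToComplex p) * sectorWeightCirc n ω (polarAngle p)) := funext hZ
    rw [hfun]
    have hb : ∀ j : Fin 2, ContDiff ℝ m fun p : Fin 2 → ℝ => gnCutoff ((π + z) ^ 2 / π ^ 2) ((π + z) ^ 2) (p j ^ 2) := fun j =>
      (contDiff_gnCutoff _ _).comp ((contDiff_apply ℝ ℝ j).pow 2)
    exact ((hb 0).mul (hb 1)).mul (contDiff_radial_mul_sectorWeightCirc_polarAngle (by norm_num) n ω)
  · -- size
    rw [abs_of_nonneg (angularFactor₁_nonneg hZ p), hZ]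
    have hg : ∀ t : ℝ, 0 ≤ gnCutoff ((π + z) ^ 2 / π ^ 2) ((π + z) ^ 2) t ∧ gnCutoff ((π + z) ^ 2 / π ^ 2) ((π + z) ^ 2) t ≤ 1 :=
      fun t => ⟨(gnCutoff_mem_Icc _ _ t).1, (gnCutoff_mem_Icc _ _ t).2⟩
    have hR : 0 ≤ radialCutoffC (1 / 2) (momToComplex p) ∧ radialCutoffC (1 / 2) (momToComplex p) ≤ 1 :=
      ⟨(radialCutoffC_mem_Icc _ _).1, (radialCutoffC_mem_Icc _ _).2⟩
    have hζ : 0 ≤ sectorWeightCirc n ω (polarAngle p) ∧ sectorWeightCirc n ω (polarAngle p) ≤ 1 :=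
      ⟨sectorWeightCirc_nonneg _ _ _, sectorWeightCirc_le_one _ _ _⟩
    exact mul_le_one₀ (mul_le_one₀ (hg _).2 (hg _).1 (hg _).2) (mul_nonneg hR.1 hζ.1) (mul_le_one₀ hR.2 hζ.1 hζ.2)
  · -- zone
    obtain ⟨j, hj⟩ := h
    have hπz : 0 ≤ π + z := by linarith [Real.pi_pos]
    have hsq : (π + z) ^ 2 ≤ p j ^ 2 := by
      rw [← sq_abs (p j)]; exact pow_le_pow_left₀ hπz hj 2
    rw [hZ]
    fin_cases j
    · rw [sqCutoff_eq_zero hz (by simpa using hsq)]; ring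
    · rw [mul_comm (gnCutoff _ _ (p 0 ^ 2)), sqCutoff_eq_zero hz (by simpa using hsq)]; ring

/-- **Near a point of the open square the square cutoffs are invisible**: along any line, if `|(p₀ + s•w)_i| < π` for both `i`, then
`σ ↦ Z(p₀ + σ•w)` agrees near `s` with the plateaued angular factor. [folklore] -/
theorem angularFactor₁_line_eventuallyEq (hz : 0 < z) (p₀ w : Fin 2 → ℝ) {s : ℝ} (hsq : ∀ i, |(p₀ + s • w) i| < π) :
    (fun σ : ℝ => Z (p₀ + σ • w)) =ᶠ[𝓝 s] fun σ =>
      radialCutoffC (1 / 2) (momToComplex (p₀ + σ • w)) * sectorWeightCirc n ω (polarAngle (p₀ + σ • w)) := by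
  have hcont : ∀ i : Fin 2, Continuous fun σ : ℝ => (p₀ + σ • w) i := fun i => by
    simp only [Pi.add_apply, Pi.smul_apply, smul_eq_mul]; fun_prop
  have hopen : ∀ i : Fin 2, ∀ᶠ σ in 𝓝 s, |(p₀ + σ • w) i| < π := fun i =>
    (continuous_abs.comp (hcont i)).continuousAt.eventually_lt continuousAt_const (hsq i)
  filter_upwards [hopen 0, hopen 1] with σ h0 h1
  rw [hZ]
  have e0 : gnCutoff ((π + z) ^ 2 / π ^ 2) ((π + z) ^ 2) ((p₀ + σ • w) 0 ^ 2) = 1 :=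
    sqCutoff_eq_one hz (by rw [← sq_abs]; exact pow_le_pow_left₀ (abs_nonneg _) h0.le 2)
  have e1 : gnCutoff ((π + z) ^ 2 / π ^ 2) ((π + z) ^ 2) ((p₀ + σ • w) 1 ^ 2) = 1 :=
    sqCutoff_eq_one hz (by rw [← sq_abs]; exact pow_le_pow_left₀ (abs_nonneg _) h1.le 2)
  rw [e0, e1, one_mul, one_mul]

end Angular

/-! ### §2 Line derivatives of one plateaued angular factor up to order three -/

/-- **Derivatives of one plateaued angular factor along a line at a point of the Fermi region** (`‖p₀ + s•w‖ ≥ 1`): for `i ≤ 3`,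
`|∂_σⁱ [R·ζ̃_{n,ω}∘θ](s)| ≤ 6B((1 + 6/w_n)‖w₁+iw₂‖)ⁱ`, `B` the constant of `exists_norm_iteratedDeriv_sectorWeightCirc_polarAngle_line_le 3`.
[cite: BenfattoGiulianiMastropietro2006, §2.5 Lemma 2.2] -/
theorem abs_iteratedDeriv_plateaued_line_le₃ {B : ℝ}
    (hB : ∀ (i : ℕ), i ≤ 3 → ∀ (n : ℕ) (ω : ℤ) (θ₀ : ℝ) (q w : Fin 2 → ℝ) (t : ℝ) {r₀ : ℝ}, 0 < r₀ →
      r₀ ≤ ‖momToComplex (q + t • w)‖ → |sectorRelAngle θ₀ (q + t • w)| < π →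
      ‖iteratedDeriv i (fun t : ℝ => sectorWeightCirc n ω (polarAngle (q + t • w))) t‖ ≤
        (3 : ℕ)! * B * ((1 + (sectorWidth n)⁻¹ * (3 : ℕ)!) * ‖momToComplex w‖ / r₀) ^ i)
    (n : ℕ) (ω : ℤ) (p₀ w : Fin 2 → ℝ) {s : ℝ} (hfermi : 1 ≤ ‖momToComplex (p₀ + s • w)‖) {i : ℕ} (hi : i ≤ 3) :
    |iteratedDeriv i (fun σ : ℝ => radialCutoffC (1 / 2) (momToComplex (p₀ + σ • w)) * sectorWeightCirc n ω (polarAngle (p₀ + σ • w))) s|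
      ≤ 6 * B * ((1 + 6 * (sectorWidth n)⁻¹) * ‖momToComplex w‖) ^ i := by
  have hcont : Continuous fun σ : ℝ => ‖momToComplex (p₀ + σ • w)‖ :=
    continuous_norm.comp (contDiff_momToComplex (m := 0) |>.continuous.comp (by fun_prop))
  have hhalf : (1 : ℝ) / 2 < ‖momToComplex (p₀ + s • w)‖ := by linarith
  have hopen : ∀ᶠ σ in 𝓝 s, (1 : ℝ) / 2 < ‖momToComplex (p₀ + σ • w)‖ :=
    hcont.continuousAt.eventually_mem (Ioi_mem_nhds hhalf)
  have hev : (fun σ : ℝ => radialCutoffC (1 / 2) (momToComplex (p₀ + σ • w)) * sectorWeightCirc n ω (polarAngle (p₀ + σ • w))) =ᶠ[𝓝 s]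
      fun σ => sectorWeightCirc n ω (polarAngle (p₀ + σ • w)) := by
    filter_upwards [hopen] with σ hσ
    rw [radialCutoffC_eq_one (by norm_num) hσ.le, one_mul]
  rw [hev.iteratedDeriv_eq]
  have h := hB i hi n ω (polarAngle (p₀ + s • w)) p₀ w s one_pos hfermi (by rw [sectorRelAngle_self, abs_zero]; exact Real.pi_pos)
  rw [Real.norm_eq_abs] at h
  refine h.trans (le_of_eq ?_)
  have h3 : ((3 : ℕ)! : ℝ) = 6 := by norm_num [Nat.factorial]
  rw [h3, div_one]
  ring

/-- **Line derivatives of the one-factor angular factor on the Fermi region of the open square, orders `1, 2, 3`**: with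
`D = (1 + 6/w_n)‖w₁ + iw₂‖`, at a point with `|(p₀+s•w)_i| < π` and `‖p₀ + s•w‖ ≥ 1`: `|∂ₛZ| ≤ 6B·D`, `|∂ₛ²Z| ≤ 6B·D²`, `|∂ₛ³Z| ≤ 6B·D³`.
[cite: BenfattoGiulianiMastropietro2006, §2.5 Lemma 2.2] -/
theorem abs_derivs_angularFactor₁_line_le {z : ℝ} (hz : 0 < z) {n : ℕ} {ω : ℤ} {Z : (Fin 2 → ℝ) → ℝ}
    (hZ : ∀ p, Z p = gnCutoff ((π + z) ^ 2 / π ^ 2) ((π + z) ^ 2) (p 0 ^ 2) * gnCutoff ((π + z) ^ 2 / π ^ 2) ((π + z) ^ 2) (p 1 ^ 2) *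
      (radialCutoffC (1 / 2) (momToComplex p) * sectorWeightCirc n ω (polarAngle p)))
    {B : ℝ}
    (hB : ∀ (i : ℕ), i ≤ 3 → ∀ (n : ℕ) (ω : ℤ) (θ₀ : ℝ) (q w : Fin 2 → ℝ) (t : ℝ) {r₀ : ℝ}, 0 < r₀ →
      r₀ ≤ ‖momToComplex (q + t • w)‖ → |sectorRelAngle θ₀ (q + t • w)| < π →
      ‖iteratedDeriv i (fun t : ℝ => sectorWeightCirc n ω (polarAngle (q + t • w))) t‖ ≤
        (3 : ℕ)! * B * ((1 + (sectorWidth n)⁻¹ * (3 : ℕ)!) * ‖momToComplex w‖ / r₀) ^ i)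
    (p₀ w : Fin 2 → ℝ) {s : ℝ} (hsq : ∀ i, |(p₀ + s • w) i| < π) (hfermi : 1 ≤ ‖momToComplex (p₀ + s • w)‖) :
    |deriv (fun σ : ℝ => Z (p₀ + σ • w)) s| ≤ 6 * B * ((1 + 6 * (sectorWidth n)⁻¹) * ‖momToComplex w‖) ∧
      |iteratedDeriv 2 (fun σ : ℝ => Z (p₀ + σ • w)) s| ≤ 6 * B * ((1 + 6 * (sectorWidth n)⁻¹) * ‖momToComplex w‖) ^ 2 ∧
      |iteratedDeriv 3 (fun σ : ℝ => Z (p₀ + σ • w)) s| ≤ 6 * B * ((1 + 6 * (sectorWidth n)⁻¹) * ‖momToComplex w‖) ^ 3 := by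
  have hev := angularFactor₁_line_eventuallyEq hZ hz p₀ w hsq
  refine ⟨?_, ?_, ?_⟩
  · have h := abs_iteratedDeriv_plateaued_line_le₃ hB n ω p₀ w hfermi (i := 1) (by norm_num)
    rw [iteratedDeriv_one, pow_one] at h
    rw [hev.deriv_eq]; exact h
  · have h := abs_iteratedDeriv_plateaued_line_le₃ hB n ω p₀ w hfermi (i := 2) (by norm_num)
    rw [hev.iteratedDeriv_eq]; exact h
  · have h := abs_iteratedDeriv_plateaued_line_le₃ hB n ω p₀ w hfermi (i := 3) le_rfl
    rw [hev.iteratedDeriv_eq]; exact h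

end Summit.HubbardSuperconductivity.HubbardSuperconductivity.Theorems.TorusFourierL2

end
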